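import Summits.ResolutionOfSingularities.ResolutionOfSingularities.Theorems.FrobeniusClosingSteerQuadraticTransformEtaleLift
import Summits.ResolutionOfSingularities.ResolutionOfSingularities.Theorems.FrobeniusClosingSteerEtaleWindowWords
import HarnessLib

/-!
# Crux `Steer` (stmt-ResolutionOfSingularities-16345), chain W4.1, K-side K3-b read against the K3 WINDOW WORDS: `LevelLift` at two levels ⟹
# the quadratic transform and its exceptional parameter lift (Theses-free, definition-free)

OURS (campaign `res-hironaka`, rung L ★L-G4, slot W4.1; seat res-D-pv-040 g8; res-L0-w41-plan-1 RULING 258 (d); res-D-lib-1's words `EtaleLift.LevelLift`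
p561951 «K3-b CONSUMES `LevelLift` at two levels»; `--supports stmt-ResolutionOfSingularities-16345 --as helper`). Pure repackaging of
`QuadraticTransformLift.isQuadraticTransform_lift'` / `span_image_maximalIdeal_lift'` (p561980): from `LevelLift S₀ S′₀ φ₀ θ` we take UNRAMIFIED and
`θ ∈ S′₀`, from `LevelLift S₁ S′₁ φ₁ θ` GENERATION and the injectivity of `φ₁` (faithful flatness at `I = ⊥`); the commuting of `φ₀, φ₁` with the
inclusions and the upstairs DOMINANCE stay explicit binders (they are inter-level data, not in `LevelLift`). Not a statement of the manuscript under
review [claim: Hironaka2017, status: under-review]; AI-produced plumbing, weaker than expert review.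

* `injective_of_levelLift` — `φ` is injective (descent form of faithful flatness at `⊥`).
* **`isQuadraticTransform_of_levelLift`** — `IsQuadraticTransform S₀ S₁ → LevelLift S₀ S′₀ φ₀ θ → LevelLift S₁ S′₁ φ₁ θ → (φ's commute) →
  SubringDominates S′₀ S′₁ → IsQuadraticTransform S′₀ S′₁`.
* **`span_image_maximalIdeal_of_levelLift`** — the `hx` binder of `K3Target.NoTangentialStepNonRationalTwo` upstairs, parameter `φ₁ x`.

[cite: Cutkosky2014, §2.1] bears_on: LADDER-RESOLUTION L ★L-G4 W4.1 (crux `Steer`, hNRW / K3; also the K3ᴳ horizon of hGW3, per step).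
-/

noncomputable section

set_option linter.dupNamespace false

open IsLocalRing

namespace Summit.ResolutionOfSingularities.ResolutionOfSingularities.Theorems.SwitchingDichotomy.QuadraticTransformLift

open Literature.AlgebraicGeometry.Resolution
open Summit.ResolutionOfSingularities.ResolutionOfSingularities.Theorems.SwitchingDichotomy.EtaleLift

variable {L L' : Type} [Field L] [Field L'] {S₀ S₁ : Subring L} {S'₀ S'₁ : Subring L'} [IsLocalRing S₀] [IsLocalRing S₁]
  [IsLocalRing S'₀] [IsLocalRing S'₁]

omit [IsLocalRing S₀] [IsLocalRing S'₀] in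
/-- A level map of the K3 base change is injective (`φ⁻¹(⊥ S′) = ⊥`). OURS. (folklore) -/
theorem injective_of_levelLift {φ : S₁ →+* S'₁} {θ : L'} (h : LevelLift S₁ S'₁ φ θ) : Function.Injective φ := by
  obtain ⟨-, -, hff, -⟩ := h
  rw [injective_iff_map_eq_zero]
  intro a ha
  have : a ∈ ((⊥ : Ideal S₁).map φ).comap φ := by
    rw [Ideal.mem_comap, ha]; exact Ideal.zero_mem _
  rw [hff ⊥] at this
  exact (Ideal.mem_bot.mp this)

/-- **K3-b against the window words: the quadratic transform lifts.** OURS. [cite: Cutkosky2014, §2.1] -/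
theorem isQuadraticTransform_of_levelLift (hqt : IsQuadraticTransform S₀ S₁) (hle : S₀ ≤ S₁) (hle' : S'₀ ≤ S'₁)
    {φ₀ : S₀ →+* S'₀} {φ₁ : S₁ →+* S'₁} {θ : L'} (h₀ : LevelLift S₀ S'₀ φ₀ θ) (h₁ : LevelLift S₁ S'₁ φ₁ θ)
    (hcomm : ∀ s : S₀, ((φ₁ (Subring.inclusion hle s) : S'₁) : L') = ((φ₀ s : S'₀) : L'))
    (hdom : SubringDominates S'₀ S'₁) : IsQuadraticTransform S'₀ S'₁ := by
  have hinj := injective_of_levelLift h₁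
  obtain ⟨-, hunr, -, hθ, -⟩ := h₀
  obtain ⟨-, -, -, -, hgen, -⟩ := h₁
  exact isQuadraticTransform_lift' hqt hle hle' φ₀ φ₁ hinj hcomm hunr hθ hgen hdom

omit [IsLocalRing S₁] [IsLocalRing S'₁] in
/-- **K3-b against the window words: the exceptional parameter generates upstairs** (`hx′` from `hx`). OURS. (folklore) -/
theorem span_image_maximalIdeal_of_levelLift (hle : S₀ ≤ S₁) (hle' : S'₀ ≤ S'₁)
    {φ₀ : S₀ →+* S'₀} (φ₁ : S₁ →+* S'₁) {θ : L'} (h₀ : LevelLift S₀ S'₀ φ₀ θ)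
    (hcomm : ∀ s : S₀, ((φ₁ (Subring.inclusion hle s) : S'₁) : L') = ((φ₀ s : S'₀) : L')) (x : S₁)
    (hx : Ideal.span ((fun y : S₀ => (⟨(y : L), hle y.2⟩ : S₁)) '' (maximalIdeal S₀ : Set S₀)) = Ideal.span {x}) :
    Ideal.span ((fun y : S'₀ => (⟨(y : L'), hle' y.2⟩ : S'₁)) '' (maximalIdeal S'₀ : Set S'₀)) = Ideal.span {φ₁ x} := by
  obtain ⟨-, hunr, -⟩ := h₀
  exact span_image_maximalIdeal_lift' hle hle' φ₀ φ₁ hcomm hunr x hx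

end Summit.ResolutionOfSingularities.ResolutionOfSingularities.Theorems.SwitchingDichotomy.QuadraticTransformLift

end
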